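import Mathlib
import HarnessLib
import Summits.NavierStokesRegularity.NavierStokesRegularity.Theses.WakeRatchet

/-!
# Route `WakeRatchet`, glue `EternalRigidityViscBddOneOfMinimalBlowup` (stmt-NavierStokesRegularity-22745) — proved

The CRITICAL-ELEMENT decomposition of the shared `K2ᵛbdd(1)` statement `EternalRigidityViscBddOne` (stmt-20420):
`MinimalViscousBlowup → MinimalBlowupExtraction → EternalRigidityViscBddOne` — modus ponens under the quantifiers with
`εs := min εs₁ εs₂` (LINE g8-1 of ideator ns-idea-1; the planner's `Sketch.lean` `eternalRigidityViscBddOne_of_minimalBlowup`,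
re-typed against the route declarations).

HONEST FRAMING: pure logic on Tao's MODEL lattice statements; both hypotheses are OPEN cruxes (22743, 22744); no rung or summit
is proved by a glue. Nothing here is about Navier–Stokes.
-/

set_option linter.dupNamespace false

namespace Summit.NavierStokesRegularity.NavierStokesRegularity.Theorems

open Summit.NavierStokesRegularity.NavierStokesRegularity.Theses.WakeRatchet

/-- **`EternalRigidityViscBddOneOfMinimalBlowup` (stmt-NavierStokesRegularity-22745)**: the resplit glue
`MinimalViscousBlowup → MinimalBlowupExtraction → EternalRigidityViscBddOne` (`εs := min εs₁ εs₂`, modus ponens).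
[cite: Tao2016AveragedNS, §4–§5 (the model cascade; statements only)] (credit: ns-idea-1 LINE g8-1 `Sketch.lean`) -/
theorem wakeRatchet_eternalRigidityViscBddOneOfMinimalBlowup_proof :
    Summit.NavierStokesRegularity.NavierStokesRegularity.Theses.WakeRatchet.EternalRigidityViscBddOneOfMinimalBlowup := by
  intro h₁ h₂ R hR
  obtain ⟨ε₁, hε₁, H₁⟩ := h₁ R hR
  obtain ⟨ε₂, hε₂, H₂⟩ := h₂ R hR
  refine ⟨min ε₁ ε₂, lt_min hε₁ hε₂, fun ε₀ hε₀ hle α X₀ hα hng => ?_⟩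
  obtain ⟨ν, T, C, c, X, hP⟩ := H₁ ε₀ hε₀ (hle.trans (min_le_left _ _)) α X₀ hα hng
  exact H₂ ε₀ hε₀ (hle.trans (min_le_right _ _)) α X₀ hα ν T C c X hP

end Summit.NavierStokesRegularity.NavierStokesRegularity.Theorems
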